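import Summits.QuantumFields.BalabanUV.Beta.CompositeCorrectorSlot
import Summits.QuantumFields.BalabanUV.Beta.AxialDressingRootedBmHessian
import Summits.QuantumFields.BalabanUV.Beta.D1BFx.HessKerConjugation
import Summits.QuantumFields.BalabanUV.Beta.ChartConjugationReflection

/-!
# `BalabanUV.Beta.CompositeCorrectorDress` — row D1 ∕ (C1), file F6e under design (D-b): THE CORRECTOR-DRESSING FUNCTOR ON JET DATA
# AND ITS `hessKer` IDENTITY — generic in the corrector (any spread `P` with a slot adjunction), instantiated at K-U3d's composite corrector
# `Ψ̂_m = psiK r L m` through F1's adjunction, and composed with the block-mean dressing (B2): the PULLED-BACK jet datum whose typed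
# one-shot kernel `TOf` IS the composite system's one-loop kernel in its own chart

WHAT.  The one-shot kernel of record `TshotOf Lc Jc m = TOf (Jc m) = hessKer (KInv (Lc^m)) (vertexOf (Jc m).S) (Jc m).W` hard-wires the STRAIGHT
chart, while the composite `m`-fold system's chart is `A = Ψ̂ ∘ G ∘ Ψ̂ᵀ`, `G = Π_bmᵀ-co-dressed KInv` (`CompositeOneShotChart`).  Under design (D-b) (F6 SPEC
ADDENDUM S-an2-g51-1 v1.2 §4; RULING R-D1-g52-1) the composite jet datum `JcComp m` is DEFINED by pulling the composite system's own jets `(𝒮, 𝒲)` back to the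
straight chart, so that (L2′) `hN` is this file's identity BY NAME.  Three bridges carry `hessKer` across: (B1) d1-p2's `hessKer_conj_kernel` (conjugation
moved onto the vertex legs), (B3) the SLOT ADJUNCTION `vertexOfK (P K Pᵀ) N 𝒮 = vertexOfK K N (slot 𝒮)` (F1 `CompositeCorrectorSlot.vertexOfK_conj_psiK` for `Ψ̂_m`;
leaf-03's `SymCorrectorSlot.vertexOfK_conj_psiKS` for the one-step symmetrised corrector), (B2) an2's `hessKer_dressBmAt` (the block-mean projector moved onto the jets).
* §1 [our object — bookkeeping] the LEG SANDWICH `sandS P 𝒮 κ u := Pᵀ ∘ 𝒮 κ u ∘ P`, `sandW P 𝒲 μ y ν y′ := Pᵀ ∘ 𝒲 μ y ν y′ ∘ P`; localisation `biLoc_sand` (rate `δ ↦ δ∕4`,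
  explicit constant `cSand`), `locStencil_sandS`, `vertexFamily₂_sandW`; THE EXCHANGE LEMMA **`sand_vertexOfK`**: `Pᵀ ∘ vertexOfK K N 𝒮 μ y ∘ P = vertexOfK K N (sandS P 𝒮) μ y`
  (an5's `comp_wsum ∕ wsum_comp` through `vertexOfK_eq_sum`; every series absolutely convergent).
* §2 **`hessKer_sand_of_adj`** — GENERIC IN THE CORRECTOR: for spread `P`, `K`, a local stencil family `𝒮`, its slot transport `𝒮′` (local stencil family) with the
  ADJUNCTION `∀ μ y, vertexOfK (P K Pᵀ) N 𝒮 μ y = vertexOfK K N 𝒮′ μ y` as a HYPOTHESIS, and a second-order family `𝒲` (localised):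
  `hessKer (P K Pᵀ) (vertexOfK (P K Pᵀ) N 𝒮) 𝒲 = hessKer K (vertexOfK K N (sandS P 𝒮′)) (sandW P 𝒲)` — (B3)-as-hypothesis + §1 + (B1).  Serves `psiK` (§3),
  `psiKS` (leaf-03's adjunction), and the symmetrised composite corrector of RULING R-D1-g52-1 (β1) the day K-U3d lands it.
* §3 THE `Ψ̂_m` INSTANCE: [our object — bookkeeping] **`dressPsiAt hL hr m J : JetData d N`** (`S := sandS Ψ̂_m (slotPsiF r L m J.S)`, `W := sandW Ψ̂_m J.W`, rate
  `J.δ∕8`, EXPLICIT constants from K-U3d's `decays_psiK` (`kerBound`) — no choice), `dressPsiAt_S ∕ _W` (`rfl`), and **`hessKer_dressPsiAt`**: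
  `hessKer K (vertexOfK K N (dressPsiAt J).S) (dressPsiAt J).W = hessKer (Ψ̂ K Ψ̂ᵀ) (vertexOfK (Ψ̂ K Ψ̂ᵀ) N J.S) J.W` for every spread `K`.
* §4 WITH THE BLOCK-MEAN DRESSING: [our object — bookkeeping] `compChart r L m s N := Ψ̂_m ∘ coDressKBmAt (toSite s) N KInv ∘ Ψ̂_mᵀ` (K-U3d's literal, `CompositeOneShotChart` §1's
  term verbatim), `pullJ hL hr m hs J := dressBmAt hs (dressPsiAt hL hr m J)`; **`hessKer_dressBmAt_dressPsiAt`** (any decaying `K`) and **`TOf_pullJ`**: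
  `TOf (pullJ … J) = hessKer (compChart r L m s N) (vertexOfK (compChart r L m s N) N J.S) J.W` — the (D-b) engine of (L2′) `hN`: F6d sets
  `JcComp (m+2) := pullJ … (𝒥N (m+2))` over the composite system's raw jets `𝒥N` and reads `hN` off this line.
WHAT THIS IS NOT: not the raw composite jets `𝒥N` (F3∕F5∕F6a∕F6c's tables packed by (A)'s naming — F6d), not `JcComp`, not the sym instance (after K-U3d's `psiKSym`);
nothing of Bałaban's asserted, valued or discharged; 0 estimates; 0∕4 row-D1 binders (hW, hR, D1Tel, D1Rep); NOT (C1), NOT (L2′) discharged, NOT (T-ID), NOT D1,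
NEVER «G-an2-4 closed», NOT BetaPertH, NOT continuum, NOT Clay.  [folklore] absolutely-convergent-sum bookkeeping over the cell's OWN typed objects BY NAME + four
[our object — bookkeeping] definitions (`sandS`, `sandW`, `dressPsiAt`, `pullJ`) + two bookkeeping abbreviations (`cSand`, `cPsi`, `compChart`); no `def … : Prop`,
nothing cited, 0 sorry.

HONEST DEPENDENCY (page 1, mandatory): continuum YM on T⁴ ⇐ BetaPertH ∧ nine spine estimates (0/9 proved); BetaPertH ⇐ (D1) ∧ (D4) ∧ CAP+tail;
G-an2-4 gates asym, D1 and NE2/3/4.  HONEST FRAMING (cell contract, verbatim): «discharging `BetaPertH` makes Bałaban's UV stability UNCONDITIONAL —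
a real constructive-QFT result; it is NOT the continuum limit and NOT the Clay problem.»  Row D1 ∕ (C1) OWNER an2, gen 52, 2026-08-24.  No existing file touched.
-/

noncomputable section

namespace Summit.QuantumFields.BalabanUV.Beta.CompositeCorrectorDress

open Finset
open scoped BigOperators
open Literature.MathematicalPhysics.QuantumFieldTheory
open Literature.MathematicalPhysics.QuantumFieldTheory.Balaban1983to89
open Literature.MathematicalPhysics.QuantumFieldTheory.Balaban1983to89.Beta
open B12Sec2to5 (l1 l1_nonneg)
open ExpKernelCalculus (MKer Decays BiLoc comp hessKer VertexFamily VertexFamily₂ Zl biLoc_comp_decays)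
open AffineAveraging (Site box toSite)
open OneStepResolventKernel (Fib KInv wsum LocStencil JetData TOf decays_KInv biLoc_mono decays_mono)
open OneStepKernelFamily (colH vertexOfK vertexOfK_KInv vertexFamily_vertexOfK')
open KernelWard (bdd_of_biLoc comp_finset_sum_right comp_finset_sum_left)
open BalabanStepJetsSucc (biLoc_comp_right)
open Summit.QuantumFields.BalabanUV.Beta.TameKernelCalculus (Spr Loc trK Spr.tame Loc.tame Spr.trK Spr.comp_loc Loc.comp_spr decays_trK slices_tame)
open Summit.QuantumFields.BalabanUV.Beta.ChartConjugationRelative (spr_comp)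
open Summit.QuantumFields.BalabanUV.Beta.ChartConjugationReflection (comp_wsum wsum_comp vertexOfK_eq_sum abs_le_of_locStencil summable_abs_colH loc_wsum_colH)
open Summit.QuantumFields.BalabanUV.Beta.AxialDressingRooted (coDressKBmAt dressBmAt spr_coDressKBmAt decays_coDressKBmAt hessKer_dressBmAt one_le_of_neZero)
open Summit.QuantumFields.BalabanUV.Beta.D1BFx.HessKerConjugation (hessKer_conj_kernel)
open Summit.QuantumFields.BalabanUV.Beta.CompositeCorrectorKernel (psiK kerBound decays_psiK spr_psiK)
open Summit.QuantumFields.BalabanUV.Beta.CompositeCorrectorSlot (slotPsiF locStencil_slotPsiF vertexOfK_conj_psiK)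

variable {d : ℕ}

/-! ## §1 The leg sandwich of stencil and vertex families by a spread kernel, and the exchange lemma -/

section Sandwich

/-- [our object — bookkeeping] THE LEG SANDWICH of a stencil family: `sandS P 𝒮 κ u := Pᵀ ∘ 𝒮 κ u ∘ P` (left-associated, as (B1)'s output). -/
def sandS (P : MKer (d + 1) (Fib d)) (S : Fin (d + 1) → Site (d + 1) → MKer (d + 1) (Fib d)) :
    Fin (d + 1) → Site (d + 1) → MKer (d + 1) (Fib d) :=
  fun κ u => comp (comp (trK P) (S κ u)) P

/-- [our object — bookkeeping] THE LEG SANDWICH of a second-order vertex family: `sandW P 𝒲 μ y ν y′ := Pᵀ ∘ 𝒲 μ y ν y′ ∘ P`. -/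
def sandW (P : MKer (d + 1) (Fib d)) (W : Fin (d + 1) → Site (d + 1) → Fin (d + 1) → Site (d + 1) → MKer (d + 1) (Fib d)) :
    Fin (d + 1) → Site (d + 1) → Fin (d + 1) → Site (d + 1) → MKer (d + 1) (Fib d) :=
  fun μ y ν y' => comp (comp (trK P) (W μ y ν y')) P

/-- [folklore] `sandS` unfolded (`rfl`). -/
theorem sandS_apply (P : MKer (d + 1) (Fib d)) (S : Fin (d + 1) → Site (d + 1) → MKer (d + 1) (Fib d)) (κ : Fin (d + 1)) (u : Site (d + 1)) :
    sandS P S κ u = comp (comp (trK P) (S κ u)) P := rfl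

/-- [folklore] `sandW` unfolded (`rfl`). -/
theorem sandW_apply (P : MKer (d + 1) (Fib d)) (W : Fin (d + 1) → Site (d + 1) → Fin (d + 1) → Site (d + 1) → MKer (d + 1) (Fib d))
    (μ : Fin (d + 1)) (y : Site (d + 1)) (ν : Fin (d + 1)) (y' : Site (d + 1)) :
    sandW P W μ y ν y' = comp (comp (trK P) (W μ y ν y')) P := rfl

/-- [our object — bookkeeping] the explicit constant of the sandwich localisation (in-rate `δ`, out-rate `δ∕4`). -/
def cSand (d : ℕ) (CP C δ : ℝ) : ℝ :=
  (Fintype.card (Fib d) : ℝ) * (((Fintype.card (Fib d) : ℝ) * (CP * C) * Zl (d + 1) (δ / 2)) * CP) * Zl (d + 1) (δ / 4)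

/-- [folklore] **SANDWICH OF A BI-LOCALISED KERNEL** between the transpose and the kernel of a decaying `P` (common rate `δ`): bi-localised at the same
points, rate `δ∕4`, constant `cSand` (`ExpKernelCalculus.biLoc_comp_decays`, then `BalabanStepJetsSucc.biLoc_comp_right`). -/
theorem biLoc_sand {P X : MKer (d + 1) (Fib d)} {p q : Site (d + 1)} {CP C δ : ℝ} (hP : Decays P CP δ) (hCP : 0 ≤ CP)
    (hX : BiLoc X p q C δ) (hδ : 0 < δ) :
    BiLoc (comp (comp (trK P) X) P) p q (cSand d CP C δ) (δ / 4) := by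
  have h1 : BiLoc (comp (trK P) X) p q ((Fintype.card (Fib d) : ℝ) * (CP * C) * Zl (d + 1) (δ - δ / 2)) (δ / 2) :=
    biLoc_comp_decays (decays_trK hP) hX (by positivity) (by linarith)
  rw [show δ - δ / 2 = δ / 2 by ring] at h1
  have hP2 : Decays P CP (δ / 2) := decays_mono hP hCP le_rfl (by linarith)
  have h2 := biLoc_comp_right h1 hP2 (show (0 : ℝ) ≤ δ / 4 by positivity) (by linarith)
  rw [show δ / 2 - δ / 4 = δ / 4 by ring] at h2
  exact h2

/-- [folklore] A local stencil family sandwiched by a decaying `P` is a local stencil family (rate `δ∕4`). -/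
theorem locStencil_sandS {P : MKer (d + 1) (Fib d)} {S : Fin (d + 1) → Site (d + 1) → MKer (d + 1) (Fib d)} {CP Cs δ : ℝ}
    (hP : Decays P CP δ) (hCP : 0 ≤ CP) (hS : LocStencil S Cs δ) (hδ : 0 < δ) :
    LocStencil (sandS P S) (cSand d CP Cs δ) (δ / 4) :=
  fun κ u => biLoc_sand hP hCP (hS κ u) hδ

/-- [folklore] A second-order vertex family sandwiched by a decaying `P` is a second-order vertex family (rate `δ∕4`). -/
theorem vertexFamily₂_sandW {N : ℕ} {P : MKer (d + 1) (Fib d)} {W : Fin (d + 1) → Site (d + 1) → Fin (d + 1) → Site (d + 1) → MKer (d + 1) (Fib d)}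
    {CP Cw δ : ℝ} (hP : Decays P CP δ) (hCP : 0 ≤ CP) (hW : VertexFamily₂ W N Cw δ) (hδ : 0 < δ) :
    VertexFamily₂ (sandW P W) N (cSand d CP Cw δ) (δ / 4) :=
  fun μ y ν y' => biLoc_sand hP hCP (hW μ y ν y') hδ

/-- [folklore] **THE EXCHANGE LEMMA**: the leg sandwich commutes with the chain-rule vertex — `Pᵀ ∘ vertexOfK K N 𝒮 μ y ∘ P = vertexOfK K N (sandS P 𝒮) μ y`
for spread `P`, decaying `K` and a local stencil family `𝒮` (the vertex is a finite sum of weighted superpositions with absolutely summable `ℋ`-column weights;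
an5's `comp_wsum` ∕ `wsum_comp`). -/
theorem sand_vertexOfK {N : ℕ} {K P : MKer (d + 1) (Fib d)} (hK : ∃ δ C : ℝ, 0 < δ ∧ 0 ≤ C ∧ Decays K C δ) (hP : Spr P)
    {S : Fin (d + 1) → Site (d + 1) → MKer (d + 1) (Fib d)} {Cs δs : ℝ} (hS : LocStencil S Cs δs) (hδs : 0 < δs)
    (μ : Fin (d + 1)) (y : Site (d + 1)) :
    comp (comp (trK P) (vertexOfK K N S μ y)) P = vertexOfK K N (sandS P S) μ y := by
  have hB : ∀ κ' u x z a b, |S κ' u x z a b| ≤ Cs := abs_le_of_locStencil hS hδs.le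
  have hCs : 0 ≤ Cs := (hS 0 0).nonneg (Sum.inl 0)
  have hWl : ∀ κ', Loc (wsum (colH K N μ y κ') (S κ')) := fun κ' => loc_wsum_colH (N := N) hK hS hδs μ y κ'
  -- a uniform bound on the once-sandwiched family `Pᵀ ∘ 𝒮 κ′ u`, at the common rate `min δs δP`
  have hP' := hP
  obtain ⟨CP, δP, hδP, hPd⟩ := hP'
  have hCP : 0 ≤ CP := hPd.nonneg (Sum.inl 0)
  have hm : 0 < min δs δP := lt_min hδs hδP
  have hSm : LocStencil S Cs (min δs δP) := fun κ' u => biLoc_mono (hS κ' u) hCs (min_le_left _ _)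
  have hPm : Decays (trK P) CP (min δs δP) := decays_trK (decays_mono hPd hCP le_rfl (min_le_right _ _))
  have h1 : ∀ κ' u, BiLoc (comp (trK P) (S κ' u)) u u
      ((Fintype.card (Fib d) : ℝ) * (CP * Cs) * Zl (d + 1) (min δs δP - min δs δP / 2)) (min δs δP / 2) :=
    fun κ' u => biLoc_comp_decays hPm (hSm κ' u) (by positivity) (by linarith)
  have hB1 : ∀ κ' u x z a b, |comp (trK P) (S κ' u) x z a b|
      ≤ (Fintype.card (Fib d) : ℝ) * (CP * Cs) * Zl (d + 1) (min δs δP - min δs δP / 2) :=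
    fun κ' u => bdd_of_biLoc (h1 κ' u) (by positivity)
  have hB1nn : 0 ≤ (Fintype.card (Fib d) : ℝ) * (CP * Cs) * Zl (d + 1) (min δs δP - min δs δP / 2) :=
    (abs_nonneg _).trans (hB1 0 0 0 0 (Sum.inl 0) (Sum.inl 0))
  rw [vertexOfK_eq_sum K S μ y,
    comp_finset_sum_right Finset.univ (fun κ' _ x z a b => slices_tame hP.trK.tame (hWl κ').tame x z a b),
    comp_finset_sum_left Finset.univ (fun κ' _ x z a b => slices_tame (hP.trK.comp_loc (hWl κ')).tame hP.tame x z a b),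
    vertexOfK_eq_sum K (sandS P S) μ y]
  refine Finset.sum_congr rfl fun κ' _ => ?_
  rw [comp_wsum hP.trK (summable_abs_colH (N := N) hK μ y κ') hCs (hB κ'),
    wsum_comp hP (summable_abs_colH (N := N) hK μ y κ') hB1nn (hB1 κ')]
  rfl

end Sandwich

/-! ## §2 The `hessKer` identity for ANY corrector with a slot adjunction -/

section Generic

/-- [folklore] **THE CORRECTOR-GENERIC DRESSING IDENTITY.**  Spread `P` and `K`; a local stencil family `𝒮`; a local stencil family `𝒮′` that IS the slot
transport of `𝒮` through `P` in the sense of the ADJUNCTION `hadj : ∀ μ y, vertexOfK (P ∘ K ∘ Pᵀ) N 𝒮 μ y = vertexOfK K N 𝒮′ μ y` ((B3): F1's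
`vertexOfK_conj_psiK` for `Ψ̂_m`, leaf-03's `vertexOfK_conj_psiKS` for `Ψ̂_S`, the sym composite corrector's when typed); a localised second-order family `𝒲`.  THEN
`hessKer (P ∘ K ∘ Pᵀ) (vertexOfK (P ∘ K ∘ Pᵀ) N 𝒮) 𝒲 μ ν z = hessKer K (vertexOfK K N (sandS P 𝒮′)) (sandW P 𝒲) μ ν z` — (B1) `hessKer_conj_kernel` + the exchange lemma. -/
theorem hessKer_sand_of_adj {N : ℕ} {P K : MKer (d + 1) (Fib d)} (hP : Spr P) (hK : Spr K)
    {S S' : Fin (d + 1) → Site (d + 1) → MKer (d + 1) (Fib d)} {Cs' δs' : ℝ} (hS' : LocStencil S' Cs' δs') (hδs' : 0 < δs')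
    (hadj : ∀ μ y, vertexOfK (comp (comp P K) (trK P)) N S μ y = vertexOfK K N S' μ y)
    {W : Fin (d + 1) → Site (d + 1) → Fin (d + 1) → Site (d + 1) → MKer (d + 1) (Fib d)} (hW : ∀ μ y ν y', Loc (W μ y ν y'))
    (μ ν : Fin (d + 1)) (z : Site (d + 1)) :
    hessKer (comp (comp P K) (trK P)) (vertexOfK (comp (comp P K) (trK P)) N S) W μ ν z
      = hessKer K (vertexOfK K N (sandS P S')) (sandW P W) μ ν z := by
  have hKd : ∃ δ C : ℝ, 0 < δ ∧ 0 ≤ C ∧ Decays K C δ := by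
    obtain ⟨C, δ, hδ, h⟩ := hK
    exact ⟨δ, C, hδ, h.nonneg (Sum.inl 0), h⟩
  have e : vertexOfK (comp (comp P K) (trK P)) N S = vertexOfK K N S' := funext fun μ' => funext fun y' => hadj μ' y'
  obtain ⟨Cv, δv, hδv, hV⟩ := vertexFamily_vertexOfK' (N := N) hKd hS' hδs'
  have lV : ∀ μ' y', Loc (vertexOfK K N S' μ' y') := fun μ' y' => ⟨_, _, Cv, δv, hδv, hV μ' y'⟩
  rw [e, hessKer_conj_kernel hP hK lV hW μ ν z]
  have eV : (fun μ' y' => comp (comp (trK P) (vertexOfK K N S' μ' y')) P) = vertexOfK K N (sandS P S') :=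
    funext fun μ' => funext fun y' => sand_vertexOfK hKd hP hS' hδs' μ' y'
  rw [eV]
  rfl

end Generic

/-! ## §3 The instance at K-U3d's composite corrector `Ψ̂_m = psiK r L m` -/

section Psi

/-- [our object — bookkeeping] the decay constant of `Ψ̂_m` at rate `δ` (K-U3d's `decays_psiK`: `kerBound Ψ̂_m (L^m) · e^{δ·2(d+1)L^m}`). -/
def cPsi (r : ℕ → (Fin (d + 1) → ℕ)) (L m : ℕ) (δ : ℝ) : ℝ :=
  kerBound (psiK r L m) (L ^ m) * Real.exp (δ * (2 * (((d : ℝ) + 1) * (L ^ m : ℕ))))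

variable {L : ℕ} (hL : 0 < L) {r : ℕ → (Fin (d + 1) → ℕ)} (hr : ∀ k, r k ∈ box (d + 1) L) (m : ℕ)

include hL hr in
/-- [folklore] `Ψ̂_m` decays at every rate `δ ≥ 0` with constant `cPsi r L m δ` (K-U3d's `decays_psiK` by name). -/
theorem decays_psiK_cPsi {δ : ℝ} (hδ : 0 ≤ δ) : Decays (psiK r L m) (cPsi r L m δ) δ :=
  decays_psiK hL hr m hδ

include hL hr in
/-- [folklore] `0 ≤ cPsi`. -/
theorem cPsi_nonneg {δ : ℝ} (hδ : 0 ≤ δ) : 0 ≤ cPsi r L m δ :=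
  (decays_psiK_cPsi hL hr m hδ).nonneg (Sum.inl 0)

include hL hr in
/-- [folklore] THE [S] SOCKET of the dressed stencil family: `sandS Ψ̂_m (slotPsiF r L m 𝒮)` is a local stencil family at rate `δ∕8` (F1's `locStencil_slotPsiF` at rate
`δ∕2`, then `locStencil_sandS`). -/
theorem locStencil_dressPsiS {S : Fin (d + 1) → Site (d + 1) → MKer (d + 1) (Fib d)} {Cs δ : ℝ} (hS : LocStencil S Cs δ) (hδ : 0 < δ) :
    LocStencil (sandS (psiK r L m) (slotPsiF r L m S))
      (cSand d (cPsi r L m (δ / 2)) (((d + 1 : ℕ) : ℝ) * (cPsi r L m δ * Cs * Zl (d + 1) (δ / 2))) (δ / 2)) (δ / 8) := by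
  have h1 : LocStencil (slotPsiF r L m S) (((d + 1 : ℕ) : ℝ) * (cPsi r L m δ * Cs * Zl (d + 1) (δ / 2))) (δ / 2) :=
    locStencil_slotPsiF (decays_psiK_cPsi hL hr m hδ.le) (cPsi_nonneg hL hr m hδ.le) hS hδ
  have h2 := locStencil_sandS (decays_psiK_cPsi hL hr m (half_pos hδ).le) (cPsi_nonneg hL hr m (half_pos hδ).le) h1 (half_pos hδ)
  rw [show δ / 2 / 4 = δ / 8 by ring] at h2
  exact h2

include hL hr in
/-- [folklore] THE [W] SOCKET of the dressed second-order family: `sandW Ψ̂_m 𝒲` is a second-order vertex family at rate `δ∕8`. -/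
theorem vertexFamily₂_dressPsiW {N : ℕ} {W : Fin (d + 1) → Site (d + 1) → Fin (d + 1) → Site (d + 1) → MKer (d + 1) (Fib d)} {Cw δ : ℝ}
    (hW : VertexFamily₂ W N Cw δ) (hδ : 0 < δ) :
    VertexFamily₂ (sandW (psiK r L m) W) N (cSand d (cPsi r L m (δ / 2)) Cw (δ / 2)) (δ / 8) := by
  have hCw : 0 ≤ Cw := (hW 0 0 0 0).nonneg (Sum.inl 0)
  have hW' : VertexFamily₂ W N Cw (δ / 2) := fun μ y ν y' => biLoc_mono (hW μ y ν y') hCw (by linarith)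
  have h := vertexFamily₂_sandW (decays_psiK_cPsi hL hr m (half_pos hδ).le) (cPsi_nonneg hL hr m (half_pos hδ).le) hW' (half_pos hδ)
  rw [show δ / 2 / 4 = δ / 8 by ring] at h
  exact h

/-- [our object — bookkeeping] **THE `Ψ̂_m`-DRESSING FUNCTOR ON JET DATA**: the stencil family slot-transported by `Ψ̂_mᵀ` (F1's `slotPsiF`) and leg-sandwiched,
the second-order family leg-sandwiched; rate `δ∕8`; explicit constants. -/
def dressPsiAt {N : ℕ} (J : JetData d N) : JetData d N where
  S := sandS (psiK r L m) (slotPsiF r L m J.S)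
  W := sandW (psiK r L m) J.W
  Cs := cSand d (cPsi r L m (J.δ / 2)) (((d + 1 : ℕ) : ℝ) * (cPsi r L m J.δ * J.Cs * Zl (d + 1) (J.δ / 2))) (J.δ / 2)
  Cw := cSand d (cPsi r L m (J.δ / 2)) J.Cw (J.δ / 2)
  δ := J.δ / 8
  δ_pos := by have := J.δ_pos; positivity
  loc := locStencil_dressPsiS hL hr m J.loc J.δ_pos
  loc₂ := vertexFamily₂_dressPsiW hL hr m J.loc₂ J.δ_pos

/-- [folklore] the dressed stencil family, by definition. -/
theorem dressPsiAt_S {N : ℕ} (J : JetData d N) (κ : Fin (d + 1)) (u : Site (d + 1)) :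
    (dressPsiAt hL hr m J).S κ u = comp (comp (trK (psiK r L m)) (slotPsiF r L m J.S κ u)) (psiK r L m) := rfl

/-- [folklore] the dressed second-order family, by definition. -/
theorem dressPsiAt_W {N : ℕ} (J : JetData d N) (μ : Fin (d + 1)) (y : Site (d + 1)) (ν : Fin (d + 1)) (y' : Site (d + 1)) :
    (dressPsiAt hL hr m J).W μ y ν y' = comp (comp (trK (psiK r L m)) (J.W μ y ν y')) (psiK r L m) := rfl

/-- [folklore] the rate of the dressed datum. -/
theorem dressPsiAt_δ {N : ℕ} (J : JetData d N) : (dressPsiAt hL hr m J).δ = J.δ / 8 := rfl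

include hL hr in
/-- [folklore] **THE `Ψ̂_m`-DRESSING LEMMA OVER AN ARBITRARY SPREAD KERNEL `K`**: for every jet datum `J`,
`hessKer K (vertexOfK K N (dressPsiAt J).S) (dressPsiAt J).W = hessKer (Ψ̂_m K Ψ̂_mᵀ) (vertexOfK (Ψ̂_m K Ψ̂_mᵀ) N J.S) J.W` — §2 at F1's adjunction `vertexOfK_conj_psiK`. -/
theorem hessKer_dressPsiAt {N : ℕ} {K : MKer (d + 1) (Fib d)} (hK : Spr K) (J : JetData d N) (μ ν : Fin (d + 1)) (z : Site (d + 1)) :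
    hessKer K (vertexOfK K N (dressPsiAt hL hr m J).S) (dressPsiAt hL hr m J).W μ ν z
      = hessKer (comp (comp (psiK r L m) K) (trK (psiK r L m))) (vertexOfK (comp (comp (psiK r L m) K) (trK (psiK r L m))) N J.S) J.W μ ν z := by
  have hΨ : Spr (psiK r L m) := spr_psiK hL hr m
  have h1 : LocStencil (slotPsiF r L m J.S) (((d + 1 : ℕ) : ℝ) * (cPsi r L m J.δ * J.Cs * Zl (d + 1) (J.δ / 2))) (J.δ / 2) :=
    locStencil_slotPsiF (decays_psiK_cPsi hL hr m J.δ_pos.le) (cPsi_nonneg hL hr m J.δ_pos.le) J.loc J.δ_pos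
  have lW : ∀ μ' y' ν' y'', Loc (J.W μ' y' ν' y'') := fun μ' y' ν' y'' => ⟨_, _, J.Cw, J.δ, J.δ_pos, J.loc₂ μ' y' ν' y''⟩
  exact (hessKer_sand_of_adj hΨ hK h1 (half_pos J.δ_pos) (fun μ' y' => vertexOfK_conj_psiK hL hr m hK J.loc J.δ_pos μ' y') lW μ ν z).symm

end Psi

/-! ## §4 With the block-mean dressing: the pulled-back jet datum and its typed one-shot kernel -/

section Pull

/-- [our object — bookkeeping] **THE COMPOSITE ONE-SHOT CHART** (K-U3d's literal, `CompositeOneShotChart.spr_compositeA`'s term verbatim): `Ψ̂_m ∘ coDressKBmAt (toSite s) N KInv ∘ Ψ̂_mᵀ`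
at blocking `N` with in-block big root `s`. -/
def compChart (r : ℕ → (Fin (d + 1) → ℕ)) (L m : ℕ) (s : Fin (d + 1) → ℕ) (N : ℕ) [NeZero N] : MKer (d + 1) (Fib d) :=
  comp (comp (psiK r L m) (coDressKBmAt (toSite s) N (KInv (N := N) (d := d)))) (trK (psiK r L m))

variable {L : ℕ} (hL : 0 < L) {r : ℕ → (Fin (d + 1) → ℕ)} (hr : ∀ k, r k ∈ box (d + 1) L) (m : ℕ)

/-- [our object — bookkeeping] **THE PULLED-BACK JET DATUM**: block-mean dressing after `Ψ̂_m`-dressing — `pullJ hs J := dressBmAt hs (dressPsiAt J)`. -/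
def pullJ {N : ℕ} [NeZero N] {s : Fin (d + 1) → ℕ} (hs : s ∈ box (d + 1) N) (J : JetData d N) : JetData d N :=
  dressBmAt hs (dressPsiAt hL hr m J)

/-- [folklore] `pullJ` unfolded (`rfl`). -/
theorem pullJ_eq {N : ℕ} [NeZero N] {s : Fin (d + 1) → ℕ} (hs : s ∈ box (d + 1) N) (J : JetData d N) :
    pullJ hL hr m hs J = dressBmAt hs (dressPsiAt hL hr m J) := rfl

include hL hr in
/-- [folklore] **BOTH DRESSINGS OVER AN ARBITRARY DECAYING KERNEL `K`**:
`hessKer K (vertexOfK K N (pullJ hs J).S) (pullJ hs J).W = hessKer A (vertexOfK A N J.S) J.W`, `A := Ψ̂_m ∘ coDressKBmAt (toSite s) N K ∘ Ψ̂_mᵀ` — (B2) then §3. -/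
theorem hessKer_dressBmAt_dressPsiAt {N : ℕ} [NeZero N] {s : Fin (d + 1) → ℕ} (hs : s ∈ box (d + 1) N) {K : MKer (d + 1) (Fib d)}
    (hK : ∃ δ C : ℝ, 0 < δ ∧ 0 ≤ C ∧ Decays K C δ) (J : JetData d N) (μ ν : Fin (d + 1)) (z : Site (d + 1)) :
    hessKer K (vertexOfK K N (dressBmAt hs (dressPsiAt hL hr m J)).S) (dressBmAt hs (dressPsiAt hL hr m J)).W μ ν z
      = hessKer (comp (comp (psiK r L m) (coDressKBmAt (toSite s) N K)) (trK (psiK r L m)))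
          (vertexOfK (comp (comp (psiK r L m) (coDressKBmAt (toSite s) N K)) (trK (psiK r L m))) N J.S) J.W μ ν z := by
  have hN : 1 ≤ N := one_le_of_neZero N
  have sK : Spr K := by
    obtain ⟨δ, C, hδ, -, h⟩ := hK
    exact ⟨C, δ, hδ, h⟩
  rw [hessKer_dressBmAt hs hK (dressPsiAt hL hr m J)]
  exact hessKer_dressPsiAt hL hr m (spr_coDressKBmAt hN hs sK) J μ ν z

include hL hr in
/-- [folklore] **THE TYPED ONE-SHOT KERNEL OF THE PULLED-BACK DATUM IS THE COMPOSITE SYSTEM's ONE-LOOP KERNEL IN ITS OWN CHART**: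
`TOf (pullJ hs J) = hessKer (compChart r L m s N) (vertexOfK (compChart r L m s N) N J.S) J.W` — the (D-b) engine of (L2′) `hN`. -/
theorem TOf_pullJ {N : ℕ} [NeZero N] {s : Fin (d + 1) → ℕ} (hs : s ∈ box (d + 1) N) (J : JetData d N) :
    TOf (N := N) (pullJ hL hr m hs J) = hessKer (compChart r L m s N) (vertexOfK (compChart r L m s N) N J.S) J.W := by
  funext μ ν z
  have eV : OneStepResolventKernel.vertexOf (N := N) (pullJ hL hr m hs J).S = vertexOfK (KInv (N := N)) N (pullJ hL hr m hs J).S :=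
    funext fun μ' => funext fun y' => (vertexOfK_KInv (N := N) _ μ' y').symm
  unfold TOf
  rw [eV]
  exact hessKer_dressBmAt_dressPsiAt hL hr m hs (decays_KInv (N := N) (d := d)) J μ ν z

end Pull

end Summit.QuantumFields.BalabanUV.Beta.CompositeCorrectorDress

end
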